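import Literature.Barriers.CriticalPhenomena.PlaquetteWalkHoleRootCutMarking
import HarnessLib

/-!
# Barrier catalogue (SAWScalingLimit): A MARKED RHOMBUS NEEDS ALL FOUR DOORS — a two-live-edge cut on one rhombus with a third
side dead EMPTIES the under route

Leaf of `PlaquetteWalkHoleRootCutMarking` (the marking law: a cut from the lower corner of the root edge with exactly two live edges,
both sides `x`, `y` of one rhombus `g`, forces every wound class-`B2a` under-walk to carry a prefix arc through `x` and an excursion arc
through `y` in `g`, with four distinct ends). Four distinct ends are the four sides of `g`: so EVERY side of `g` is a mid-edge of the
walk, hence a live door (both faces in `D`) — unless it is the root edge itself, the walk's first mid-edge.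

§1 ★★★★ `ΩG.faces_mem_of_side_of_twoLive_cut` — under the marking-law hypotheses, every side of `g` other than the root edge has both
faces in `D`. ★★★★★ `ΩG.AJ_root_eq_zero_of_twoLive_cut_deadSide` / `ΩG.WE_eq_excursionWinding_of_under_twoLive_cut_deadSide` — **THE
THIRD-SIDE LAW**: if some side of `g` (not the root edge) is dead, no class-`B2a` under-walk at the far cell is wound. This is the
mechanism of the lane's `PlaquetteWalkHoleRootWallPocket` (the western pocket on the wall: cut `[hole.S, holeS.W, farSW.S, pocketSW.E,
farWW.S]`, live edges `farSW.E`, `farSW.S`, dead third side `farSW.W`) and of every «dead-end clause» of the kill chains.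
§2 New instances (general `D`, then boxes with ANY further defects `S ∋ h` missing the far cell): ★★★★★
`ΩG.WE_eq_excursionWinding_of_under_killSW_pocketSW_column` — `K_S2` with the far cell's column shut below it down to a floor AND the
western pocket `pocketSW w = (w.1 − 3, w.2 − 1)` absent ⇒ NO WOUND UNDER-WALK (the `w₂`-kill of `K_S2` becomes an emptiness; box:
`h.2 = 2`, `K_S2 = (h.1 − 2, 0)` and `pocketSW = (h.1 − 2, 1)` removed, `lawL_box_killSW_pocketSW_h2_not_wound_under`); ★★★★★
`ΩG.WE_eq_excursionWinding_of_under_killSE_holeS_eastWall` / `…_killSE_rootSS_eastWall` — `K_S1` on the east wall (no face in the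
columns `≥ w.1 + 2`) AND `holeS = (w.1 − 1, w.2 − 1)` (resp. `rootSS = (w.1, w.2 − 2)`) absent ⇒ NO WOUND UNDER-WALK (the `w₁`-kill of `K_S1` becomes
an emptiness when `rootS` loses its west or south door; boxes `h.1 + 3 = m`: `lawL_box_killSE_holeS_eastCol_not_wound_under`,
`lawL_box_killSE_rootSS_eastCol_not_wound_under`).

Not in print; venture lane «pcv-sawmu», seat b-step0 gen 29 (FINDING-YB-KILL-FORCED-ZEROS §28).

References: A. Glazman, I. Manolescu, arXiv:1708.00395v3, §1 (Fig. 1: two arcs in a rhombus use its four sides), §2.1, Lemma 2.1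
[GlazmanManolescu2019]; A. Glazman, Electron. Commun. Probab. 20 (2015) no. 86, Lemma 3.1, proof pp. 6–7 [Glazman2015WeightedSAW];
R. Courant, H. Robbins, *What is Mathematics?* (1941/1958), Ch. V Appendix §2 (the even–odd rule) [CourantRobbins1958].
-/

noncomputable section

open Set Function Complex
open Literature.Topology.PlaneTopology

namespace Literature.Probability.RandomPlanarGeometry.SAW.YangBaxter

open Real

open private fc_ne from Literature.Probability.RandomPlanarGeometry.YangBaxterSAWGeneralDomain
open private len_eq from Literature.Probability.RandomPlanarGeometry.YangBaxterSAWExcursionJordan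

namespace ΩG

variable {D : Set Face} {w : Face} {ω : ΩG D (w.side .W) (farW w)}

/-! ## §1 A marked rhombus has four live doors -/

/-- Four pairwise distinct sides are all the sides. [cite: GlazmanManolescu2019, §1, Fig. 4 (the four sides of a rhombus)] -/
private theorem side_cases_of_four : ∀ a b c d z : Side, a ≠ b → a ≠ c → a ≠ d → b ≠ c → b ≠ d → c ≠ d →
    z = a ∨ z = b ∨ z = c ∨ z = d := by
  decide

/-- **An end of an arc of the walk is a live door, unless it is the root**: for `j ≤ length` with `1 ≤ j`, both faces of `nth j` lie in
`D` (for the last index: the far cell and the face of the last arc). [cite: Glazman2015WeightedSAW, Lemma 3.1 (proof, pp. 6–7)] -/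
theorem faces_mem_of_nth (hr : RootedFace D (w.side .W) (farW w)) (h : ω.IsB2a) {j : ℕ} (hj1 : 1 ≤ j)
    (hj : j ≤ ω.2.arcs.length) : (ω.2.nth j).faces.1 ∈ D ∧ (ω.2.nth j).faces.2 ∈ D := by
  have hF := ω.fh_lt h
  have hM := ω.three_le_Mv hr h
  have hlen : ω.2.arcs.length = ω.2.firstHitG + ω.Mv := len_eq h
  rcases Nat.lt_or_ge j ω.2.arcs.length with hlt | hge
  · exact ω.2.door_nth (j := j) (by omega) hlt
  · have heq : j = ω.2.arcs.length := by omega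
    obtain ⟨-, h2, -⟩ := ω.2.side_sIn_nth (i := ω.2.arcs.length - 1) (by omega)
    rw [show ω.2.arcs.length - 1 + 1 = ω.2.arcs.length by omega] at h2
    rw [heq]
    exact door_of_two_faces ⟨_, h2⟩ ⟨ω.1, ω.2.nth_length.symm⟩
      (fc_ne ω hr h (by omega) (by omega)) (YBWalk.arcFace_arcAt (γ := ω.2) (by omega)).2 hr.mem

/-- ★★★★ **A MARKED RHOMBUS HAS FOUR LIVE DOORS.** Under the hypotheses of the marking law (hole absent; a cut from the lower corner of the
root edge to beyond the domain, all edges dead except two, which are two sides `x`, `y` of one rhombus `g` other than the far cell; `ω` a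
class-`B2a` under-walk whose excursion polygon winds around the root), every side `z` of `g` whose mid-edge is not the root edge has both
faces in `D`. [cite: GlazmanManolescu2019, §1, Fig. 1 (two arcs in a rhombus use its four sides)]
[cite: Glazman2015WeightedSAW, Lemma 3.1 (proof, pp. 6–7)] [cite: CourantRobbins1958, Ch. V Appendix §2 (the even–odd rule)] -/
theorem faces_mem_of_side_of_twoLive_cut (hh : holeFaceW w ∉ D) (hr : RootedFace D (w.side .W) (farW w)) (h : ω.IsB2a)
    (hS : ω.2.firstSideG = .S) {q : ℕ → ℤ × ℤ} {c : ℕ → Face} {s : ℕ → Side} {K : ℕ} (hq0 : q 0 = w)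
    (hseg : ∀ k, k < K → segment ℝ (toC (cornerPt (q k))) (toC (cornerPt (q (k + 1)))) = sideSeg (c k) (s k))
    (h1 : ∀ k, k < K → (c k).side (s k) ≠ (holeFaceW w).side .W) (h2 : ∀ k, k < K → (c k).side (s k) ≠ w.side .W)
    (hexit : (∀ f : Face, f ∈ D → f.1 < (q K).1) ∨ (∀ f : Face, f ∈ D → (q K).1 ≤ f.1) ∨
      (∀ f : Face, f ∈ D → (q K).2 ≤ f.2) ∨ (∀ f : Face, f ∈ D → f.2 < (q K).2))
    {i k : ℕ} (hik : i < k)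
    (hdead : ∀ k', k' < K → k' ≠ i → k' ≠ k →
      ((c k').side (s k')).faces.1 ∉ D ∨ ((c k').side (s k')).faces.2 ∉ D)
    {g : Face} (hg : g ≠ farW w) {x y : Side} (hci : (c i).side (s i) = g.side x) (hck : (c k).side (s k) = g.side y)
    (hA : ω.AJ hr h (toC (midPt (w.side .W))) ≠ 0) {z : Side} (hz : g.side z ≠ w.side .W) :
    (g.side z).faces.1 ∈ D ∧ (g.side z).faces.2 ∈ D := by
  have hF := ω.fh_lt h
  obtain ⟨m, m', hmF, hm'F, hm'n, hfm, hfm', hx, hy1, hy2, hio, hy, hx1, hx2, hio', -⟩ :=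
    exists_two_arcs_of_twoLive_cut hh hr h hS hq0 hseg h1 h2 hexit hik hdead hg hci hck hA
  obtain ⟨hin, hout, -⟩ := ω.2.side_sIn_nth (i := m) (by omega)
  obtain ⟨hin', hout', -⟩ := ω.2.side_sIn_nth (i := m') hm'n
  rw [hfm] at hin hout
  rw [hfm'] at hin' hout'
  -- the other ends of the two arcs differ: the mid-edges `nth m`, `nth (m+1)` and `nth m'`, `nth (m'+1)` are four distinct ones
  have hne : ∀ {a b : Side}, g.side a = ω.2.nth m ∨ g.side a = ω.2.nth (m + 1) →
      g.side b = ω.2.nth m' ∨ g.side b = ω.2.nth (m' + 1) → a ≠ b := by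
    intro a b ha hb hab
    subst hab
    rcases ha with ha | ha <;> rcases hb with hb | hb <;>
      (have := ω.2.nth_inj (by omega) (by omega) (ha.symm.trans hb); omega)
  have hsi : g.side (ω.2.sIn m) = ω.2.nth m ∨ g.side (ω.2.sIn m) = ω.2.nth (m + 1) := Or.inl hin
  have hso : g.side (ω.2.sOut m) = ω.2.nth m ∨ g.side (ω.2.sOut m) = ω.2.nth (m + 1) := Or.inr hout
  have hsi' : g.side (ω.2.sIn m') = ω.2.nth m' ∨ g.side (ω.2.sIn m') = ω.2.nth (m' + 1) := Or.inl hin'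
  have hso' : g.side (ω.2.sOut m') = ω.2.nth m' ∨ g.side (ω.2.sOut m') = ω.2.nth (m' + 1) := Or.inr hout'
  have hcases := side_cases_of_four (ω.2.sIn m) (ω.2.sOut m) (ω.2.sIn m') (ω.2.sOut m') z hio (hne hsi hsi')
    (hne hsi hso') (hne hso hsi') (hne hso hso') hio'
  -- `z` is an end of one of the two arcs: its mid-edge is `nth j` for some `1 ≤ j ≤ length` (not `0`: that is the root)
  have key : ∃ j, j ≤ ω.2.arcs.length ∧ g.side z = ω.2.nth j := by
    rcases hcases with e | e | e | e <;> rw [e]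
    · exact ⟨m, by omega, hin⟩
    · exact ⟨m + 1, by omega, hout⟩
    · exact ⟨m', by omega, hin'⟩
    · exact ⟨m' + 1, by omega, hout'⟩
  obtain ⟨j, hj, ej⟩ := key
  have hj1 : 1 ≤ j := by
    by_contra hj0
    have : j = 0 := by omega
    rw [this, ω.2.nth_zero] at ej
    exact hz ej
  rw [ej]
  exact faces_mem_of_nth hr h hj1 hj

/-- ★★★★★ **THE THIRD-SIDE LAW.** Under the marking-law hypotheses (two live edges on the cut, both sides of one rhombus `g ≠ farW w`), if
some side `z` of `g`, not the root edge, is DEAD (a face absent), then the excursion polygon of NO class-`B2a` under-walk at the far cell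
winds around the root. [cite: GlazmanManolescu2019, §1, Fig. 1 (two arcs in a rhombus use its four sides)]
[cite: Glazman2015WeightedSAW, Lemma 3.1 (proof, pp. 6–7)] [cite: CourantRobbins1958, Ch. V Appendix §2 (the even–odd rule)] -/
theorem AJ_root_eq_zero_of_twoLive_cut_deadSide (hh : holeFaceW w ∉ D) {q : ℕ → ℤ × ℤ} {c : ℕ → Face} {s : ℕ → Side}
    {K : ℕ} (hq0 : q 0 = w)
    (hseg : ∀ k, k < K → segment ℝ (toC (cornerPt (q k))) (toC (cornerPt (q (k + 1)))) = sideSeg (c k) (s k))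
    (h1 : ∀ k, k < K → (c k).side (s k) ≠ (holeFaceW w).side .W) (h2 : ∀ k, k < K → (c k).side (s k) ≠ w.side .W)
    (hexit : (∀ f : Face, f ∈ D → f.1 < (q K).1) ∨ (∀ f : Face, f ∈ D → (q K).1 ≤ f.1) ∨
      (∀ f : Face, f ∈ D → (q K).2 ≤ f.2) ∨ (∀ f : Face, f ∈ D → f.2 < (q K).2))
    {i k : ℕ} (hik : i < k)
    (hdead : ∀ k', k' < K → k' ≠ i → k' ≠ k →
      ((c k').side (s k')).faces.1 ∉ D ∨ ((c k').side (s k')).faces.2 ∉ D)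
    {g : Face} (hg : g ≠ farW w) {x y : Side} (hci : (c i).side (s i) = g.side x) (hck : (c k).side (s k) = g.side y)
    {z : Side} (hz : g.side z ≠ w.side .W) (hzd : (g.side z).faces.1 ∉ D ∨ (g.side z).faces.2 ∉ D)
    (ω : ΩG D (w.side .W) (farW w)) (hr : RootedFace D (w.side .W) (farW w)) (h : ω.IsB2a)
    (hS : ω.2.firstSideG = .S) : ω.AJ hr h (toC (midPt (w.side .W))) = 0 := by
  by_contra hA
  have hl := faces_mem_of_side_of_twoLive_cut hh hr h hS hq0 hseg h1 h2 hexit hik hdead hg hci hck hA hz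
  rcases hzd with hd | hd
  · exact hd hl.1
  · exact hd hl.2

/-- ★★★★★ **THE THIRD-SIDE LAW, winding form** (either orientation of the witness): a two-live-edge cut on one rhombus with a third side
dead ⇒ no class-`B2a` under-walk at the far cell is wound.
[cite: GlazmanManolescu2019, Lemma 2.1 (statement, "in the form given in [Gl]"), §1 (Fig. 1)]
[cite: Glazman2015WeightedSAW, Lemma 3.1 (proof, pp. 6–7)] [cite: CourantRobbins1958, Ch. V Appendix §2 (the even–odd rule)] -/
theorem WE_eq_excursionWinding_of_under_twoLive_cut_deadSide (hh : holeFaceW w ∉ D) {q : ℕ → ℤ × ℤ} {c : ℕ → Face}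
    {s : ℕ → Side} {K : ℕ} (hq0 : q 0 = w)
    (hseg : ∀ k, k < K → segment ℝ (toC (cornerPt (q k))) (toC (cornerPt (q (k + 1)))) = sideSeg (c k) (s k))
    (h1 : ∀ k, k < K → (c k).side (s k) ≠ (holeFaceW w).side .W) (h2 : ∀ k, k < K → (c k).side (s k) ≠ w.side .W)
    (hexit : (∀ f : Face, f ∈ D → f.1 < (q K).1) ∨ (∀ f : Face, f ∈ D → (q K).1 ≤ f.1) ∨
      (∀ f : Face, f ∈ D → (q K).2 ≤ f.2) ∨ (∀ f : Face, f ∈ D → f.2 < (q K).2))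
    {i k : ℕ} (hik : i < k)
    (hdead : ∀ k', k' < K → k' ≠ i → k' ≠ k →
      ((c k').side (s k')).faces.1 ∉ D ∨ ((c k').side (s k')).faces.2 ∉ D)
    {g : Face} (hg : g ≠ farW w) {x y : Side} (hci : (c i).side (s i) = g.side x) (hck : (c k).side (s k) = g.side y)
    {z : Side} (hz : g.side z ≠ w.side .W) (hzd : (g.side z).faces.1 ∉ D ∨ (g.side z).faces.2 ∉ D)
    (ω : ΩG D (w.side .W) (farW w)) (hr : RootedFace D (w.side .W) (farW w)) (h : ω.IsB2a)
    (hS : ω.2.firstSideG = .S) (θ : ℝ) :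
    ω.WE (fun _ => θ) = excursionWinding θ ω.2.firstSideG (ω.z1 hr h) ω.1 := by
  by_contra hW
  rcases ω.AJ_ne_zero_or_rev_of_wound hr h θ hW with hA | hA
  · exact hA (AJ_root_eq_zero_of_twoLive_cut_deadSide hh hq0 hseg h1 h2 hexit hik hdead hg hci hck hz hzd ω hr h hS)
  · have h' := ω.rev_isB2a hr h
    have hS' : (ω.rev hr).2.firstSideG = .S := by rw [ω.rev_firstSide hr h]; exact hS
    exact hA (AJ_root_eq_zero_of_twoLive_cut_deadSide hh hq0 hseg h1 h2 hexit hik hdead hg hci hck hz hzd (ω.rev hr) hr h' hS')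

/-! ## §2 New emptinesses: a kill cell plus one more dead door of the marked rhombus -/

/-- No side of `rootS` is the root edge. [cite: GlazmanManolescu2019, §1 (the lattice of rhombi and its mid-edges)] -/
private theorem rootS_side_ne_rootM (w : Face) (z : Side) : (rootS w).side z ≠ w.side .W := by
  obtain ⟨a, b⟩ := w; cases z <;> simp [rootS, Face.side]

/-- No side of `farSW` is the root edge. [cite: GlazmanManolescu2019, §1 (the lattice of rhombi and its mid-edges)] -/
private theorem farSW_side_ne_rootM (w : Face) (z : Side) : (farSW w).side z ≠ w.side .W := by
  obtain ⟨a, b⟩ := w; cases z <;> simp [farSW, Face.side]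

/-- ★★★★★ **`K_S1` ON THE EAST WALL WITH ONE MORE DEAD DOOR OF `rootS` ⇒ NO WOUND UNDER-WALK.** Hole and `killSE w` absent, no face of
`D` in the columns `≥ w.1 + 2`, and some side `z` of `rootS w` dead (a face absent) — e.g. `holeS = (w.1 − 1, w.2 − 1)` absent (`z = W`)
or `(w.1, w.2 − 2)` (`rootSS`) absent (`z = S`); the case `rootS w ∉ D` itself is `RootNotchEast`. Then no class-`B2a` under-walk at the far cell is wound:
the marking law would put two arcs into `rootS` through all four of its sides.
[cite: GlazmanManolescu2019, Lemma 2.1 (statement, "in the form given in [Gl]"), §1 (Fig. 1)]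
[cite: Glazman2015WeightedSAW, Lemma 3.1 (proof, pp. 6–7)] [cite: CourantRobbins1958, Ch. V Appendix §2 (the even–odd rule)] -/
theorem WE_eq_excursionWinding_of_under_killSE_eastWall_deadSide (hh : holeFaceW w ∉ D) (hK : killSE w ∉ D)
    (heast : ∀ f : Face, f ∈ D → f.1 < w.1 + 2) {z : Side}
    (hzd : ((rootS w).side z).faces.1 ∉ D ∨ ((rootS w).side z).faces.2 ∉ D)
    (ω : ΩG D (w.side .W) (farW w)) (hr : RootedFace D (w.side .W) (farW w)) (h : ω.IsB2a)
    (hS : ω.2.firstSideG = .S) (θ : ℝ) :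
    ω.WE (fun _ => θ) = excursionWinding θ ω.2.firstSideG (ω.z1 hr h) ω.1 := by
  refine WE_eq_excursionWinding_of_under_twoLive_cut_deadSide hh
    (q := fun k => if k = 0 then (w.1, w.2) else if k = 1 then (w.1 + 1, w.2) else if k = 2 then (w.1 + 1, w.2 - 1)
      else if k = 3 then (w.1 + 1, w.2 - 2) else (w.1 + 2, w.2 - 2))
    (c := fun k => if k = 0 then w else if k = 1 then (w.1 + 1, w.2 - 1) else (w.1 + 1, w.2 - 2))
    (s := fun k => if k = 0 ∨ k = 3 then Side.S else Side.W) (K := 4)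
    (by simp) (fun k hk => ?_) (fun k hk => ?_) (fun k hk => ?_) (Or.inl fun f hf => ?_)
    (i := 0) (k := 1) zero_lt_one (fun k' hk' h0 h1' => ?_) (g := rootS w) (rootS_ne_farW w) (x := .N) (y := .E)
    ?_ ?_ (rootS_side_ne_rootM w z) hzd ω hr h hS θ
  · interval_cases k
    · simpa using segment_cornerPt_east ((w.1, w.2) : ℤ × ℤ)
    · simpa using segment_cornerPt_south ((w.1 + 1, w.2) : ℤ × ℤ)
    · have := segment_cornerPt_south ((w.1 + 1, w.2 - 1) : ℤ × ℤ)
      norm_num at this ⊢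
      rw [show w.2 - 1 - 1 = w.2 - 2 by ring] at this
      exact this
    · have := segment_cornerPt_east ((w.1 + 1, w.2 - 2) : ℤ × ℤ)
      norm_num at this ⊢
      rw [show w.1 + 1 + 1 = w.1 + 2 by ring] at this
      exact this
  · interval_cases k <;> (obtain ⟨a, b⟩ := w; simp [holeFaceW, Face.side])
  · interval_cases k <;> (obtain ⟨a, b⟩ := w; simp [Face.side])
  · have := heast f hf; norm_num; omega
  · have hk2 : k' = 2 ∨ k' = 3 := by omega
    rcases hk2 with rfl | rfl
    · right
      have e : killSE w = (w.1 + 1, w.2 - 2) := by obtain ⟨a, b⟩ := w; simp [killSE]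
      norm_num [Face.side, MidEdge.faces]; rw [e] at hK; exact hK
    · right
      have e : killSE w = (w.1 + 1, w.2 - 2) := by obtain ⟨a, b⟩ := w; simp [killSE]
      norm_num [Face.side, MidEdge.faces]
      rw [e] at hK; exact hK
  · norm_num; exact root_side_S_eq_rootS_side_N w
  · norm_num; obtain ⟨a, b⟩ := w; simp [rootS, Face.side]

/-- ★★★★★ **`K_S1` on the east wall and `holeS` absent ⇒ no wound under-walk** (`rootS` keeps no west door).
[cite: GlazmanManolescu2019, Lemma 2.1 (statement, "in the form given in [Gl]"), §1 (Fig. 1)]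
[cite: Glazman2015WeightedSAW, Lemma 3.1 (proof, pp. 6–7)] [cite: CourantRobbins1958, Ch. V Appendix §2 (the even–odd rule)] -/
theorem WE_eq_excursionWinding_of_under_killSE_holeS_eastWall (hh : holeFaceW w ∉ D) (hK : killSE w ∉ D)
    (hHS : ((w.1 - 1, w.2 - 1) : Face) ∉ D) (heast : ∀ f : Face, f ∈ D → f.1 < w.1 + 2)
    (ω : ΩG D (w.side .W) (farW w)) (hr : RootedFace D (w.side .W) (farW w)) (h : ω.IsB2a)
    (hS : ω.2.firstSideG = .S) (θ : ℝ) :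
    ω.WE (fun _ => θ) = excursionWinding θ ω.2.firstSideG (ω.z1 hr h) ω.1 := by
  refine WE_eq_excursionWinding_of_under_killSE_eastWall_deadSide hh hK heast (z := .W) (Or.inl ?_) ω hr h hS θ
  have e : ((rootS w).side .W).faces.1 = (w.1 - 1, w.2 - 1) := by obtain ⟨a, b⟩ := w; simp [rootS, Face.side, MidEdge.faces]
  rw [e]; exact hHS

/-- ★★★★★ **`K_S1` on the east wall and `rootSS` absent ⇒ no wound under-walk** (`rootS` keeps no south door).
[cite: GlazmanManolescu2019, Lemma 2.1 (statement, "in the form given in [Gl]"), §1 (Fig. 1)]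
[cite: Glazman2015WeightedSAW, Lemma 3.1 (proof, pp. 6–7)] [cite: CourantRobbins1958, Ch. V Appendix §2 (the even–odd rule)] -/
theorem WE_eq_excursionWinding_of_under_killSE_rootSS_eastWall (hh : holeFaceW w ∉ D) (hK : killSE w ∉ D)
    (hSS : ((w.1, w.2 - 2) : Face) ∉ D) (heast : ∀ f : Face, f ∈ D → f.1 < w.1 + 2)
    (ω : ΩG D (w.side .W) (farW w)) (hr : RootedFace D (w.side .W) (farW w)) (h : ω.IsB2a)
    (hS : ω.2.firstSideG = .S) (θ : ℝ) :
    ω.WE (fun _ => θ) = excursionWinding θ ω.2.firstSideG (ω.z1 hr h) ω.1 := by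
  refine WE_eq_excursionWinding_of_under_killSE_eastWall_deadSide hh hK heast (z := .S) (Or.inl ?_) ω hr h hS θ
  have e : ((rootS w).side .S).faces.1 = (w.1, w.2 - 2) := by
    obtain ⟨a, b⟩ := w; simp [rootS, Face.side, MidEdge.faces]; ring
  rw [e]; exact hSS

/-- ★★★★★ **`K_S2` WITH THE FAR CELL'S COLUMN SHUT BELOW AND THE WESTERN POCKET ABSENT ⇒ NO WOUND UNDER-WALK.** Hole, `killSW w` and
`pocketSW w = (w.1 − 3, w.2 − 1)` absent; for some floor `Y ≤ w.2 − 2` no face below row `Y` and the west sides of column `w.1 − 2` dead in the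
rows `Y, …, w.2 − 3`. The marking law would put two arcs into `farSW` through all four sides, but its west door is dead. (The `w₂`-kill of
`K_S2` becomes an emptiness; with the far cell's western neighbour on the wall this is `PlaquetteWalkHoleRootWallPocket`, here the column may
stand anywhere.) [cite: GlazmanManolescu2019, Lemma 2.1 (statement, "in the form given in [Gl]"), §1 (Fig. 1)]
[cite: Glazman2015WeightedSAW, Lemma 3.1 (proof, pp. 6–7)] [cite: CourantRobbins1958, Ch. V Appendix §2 (the even–odd rule)] -/
theorem WE_eq_excursionWinding_of_under_killSW_pocketSW_column (hh : holeFaceW w ∉ D) (hK : killSW w ∉ D)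
    (hP : pocketSW w ∉ D) {Y : ℤ} (hY : Y ≤ w.2 - 2)
    (hcol : ∀ y : ℤ, Y ≤ y → y ≤ w.2 - 3 → ((w.1 - 3, y) : Face) ∉ D ∨ ((w.1 - 2, y) : Face) ∉ D)
    (hfloor : ∀ f : Face, f ∈ D → Y ≤ f.2)
    (ω : ΩG D (w.side .W) (farW w)) (hr : RootedFace D (w.side .W) (farW w)) (h : ω.IsB2a)
    (hS : ω.2.firstSideG = .S) (θ : ℝ) :
    ω.WE (fun _ => θ) = excursionWinding θ ω.2.firstSideG (ω.z1 hr h) ω.1 := by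
  set K : ℕ := (w.2 + 2 - Y).toNat with hKdef
  have hK4 : 4 ≤ K := by rw [hKdef]; omega
  have hKZ : (K : ℤ) = w.2 + 2 - Y := by rw [hKdef]; omega
  refine WE_eq_excursionWinding_of_under_twoLive_cut_deadSide hh
    (q := fun k => if k = 0 then (w.1, w.2) else if k = 1 then (w.1 - 1, w.2) else if k = 2 then (w.1 - 1, w.2 - 1)
      else (w.1 - 2, w.2 + 2 - k))
    (c := fun k => if k = 0 then (w.1 - 1, w.2) else if k = 1 then (w.1 - 1, w.2 - 1) else if k = 2 then (w.1 - 2, w.2 - 1)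
      else (w.1 - 2, w.2 + 1 - k))
    (s := fun k => if k = 0 ∨ k = 2 then Side.S else Side.W) (K := K)
    (by simp) (fun k hk => ?_) (fun k hk => ?_) (fun k hk => ?_) (Or.inr (Or.inr (Or.inl fun f hf => ?_)))
    (i := 1) (k := 2) one_lt_two (fun k' hk' h0 h1' => ?_) (g := farSW w) (farSW_ne_farW w) (x := .E) (y := .S)
    ?_ ?_ (farSW_side_ne_rootM w .W) (Or.inl ?_) ω hr h hS θ
  · rcases (by omega : k = 0 ∨ k = 1 ∨ k = 2 ∨ 3 ≤ k) with rfl | rfl | rfl | hk3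
    · simpa using segment_cornerPt_west ((w.1, w.2) : ℤ × ℤ)
    · simpa using segment_cornerPt_south ((w.1 - 1, w.2) : ℤ × ℤ)
    · have := segment_cornerPt_west ((w.1 - 1, w.2 - 1) : ℤ × ℤ)
      norm_num at this ⊢
      rw [show w.1 - 1 - 1 = w.1 - 2 by ring] at this
      rw [show w.2 + 2 - 3 = w.2 - 1 by ring]
      exact this
    · simp only [if_neg (show k ≠ 0 by omega), if_neg (show k ≠ 1 by omega), if_neg (show k ≠ 2 by omega),
        if_neg (show k + 1 ≠ 0 by omega), if_neg (show k + 1 ≠ 1 by omega), if_neg (show k + 1 ≠ 2 by omega),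
        show ¬(k = 0 ∨ k = 2) by omega, Nat.cast_add, Nat.cast_one]
      have := segment_cornerPt_south ((w.1 - 2, w.2 + 2 - k) : ℤ × ℤ)
      simp only at this
      rw [show w.2 + 2 - (k : ℤ) - 1 = w.2 + 1 - k by ring] at this
      rw [show w.2 + 2 - ((k : ℤ) + 1) = w.2 + 1 - k by ring]
      exact this
  · rcases (by omega : k = 0 ∨ k = 1 ∨ k = 2 ∨ 3 ≤ k) with rfl | rfl | rfl | hk3
    · obtain ⟨a, b⟩ := w; simp [holeFaceW, Face.side]
    · obtain ⟨a, b⟩ := w; simp [holeFaceW, Face.side]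
    · obtain ⟨a, b⟩ := w; simp [holeFaceW, Face.side]
    · simp only [if_neg (show k ≠ 0 by omega), if_neg (show k ≠ 1 by omega), if_neg (show k ≠ 2 by omega),
        show ¬(k = 0 ∨ k = 2) by omega, if_false]
      obtain ⟨a, b⟩ := w; simp [holeFaceW, Face.side]
  · rcases (by omega : k = 0 ∨ k = 1 ∨ k = 2 ∨ 3 ≤ k) with rfl | rfl | rfl | hk3
    · obtain ⟨a, b⟩ := w; simp [Face.side]
    · obtain ⟨a, b⟩ := w; simp [Face.side]
    · obtain ⟨a, b⟩ := w; simp [Face.side]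
    · simp only [if_neg (show k ≠ 0 by omega), if_neg (show k ≠ 1 by omega), if_neg (show k ≠ 2 by omega),
        show ¬(k = 0 ∨ k = 2) by omega, if_false]
      obtain ⟨a, b⟩ := w; simp [Face.side]
  · have := hfloor f hf
    simp only [if_neg (show K ≠ 0 by omega), if_neg (show K ≠ 1 by omega), if_neg (show K ≠ 2 by omega), hKZ]
    omega
  · rcases (by omega : k' = 0 ∨ k' = 3 ∨ 4 ≤ k') with rfl | rfl | hk4
    · right
      have e : holeFaceW w = (w.1 - 1, w.2) := by obtain ⟨a, b⟩ := w; simp [holeFaceW]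
      simpa [Face.side, MidEdge.faces, e] using hh
    · left
      have e : killSW w = (w.1 - 2 - 1, w.2 + 1 - ((3 : ℕ) : ℤ)) := Prod.ext (by simp [killSW]; ring) (by simp [killSW]; ring)
      norm_num [Face.side, MidEdge.faces]
      rw [e] at hK; norm_num at hK; exact hK
    · simp only [if_neg (show k' ≠ 0 by omega), if_neg (show k' ≠ 1 by omega), if_neg (show k' ≠ 2 by omega),
        show ¬(k' = 0 ∨ k' = 2) by omega, if_false]
      have hk'K : (k' : ℤ) ≤ w.2 + 1 - Y := by omega
      rcases hcol (w.2 + 1 - k') (by omega) (by omega) with hd | hd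
      · left
        have e : ((w.1 - 3, w.2 + 1 - k') : Face) = (w.1 - 2 - 1, w.2 + 1 - k') := Prod.ext (by simp only; ring) rfl
        simpa [Face.side, MidEdge.faces, e] using hd
      · right; simpa [Face.side, MidEdge.faces] using hd
  · norm_num; obtain ⟨a, b⟩ := w; simp [farSW, Face.side]; ring
  · norm_num; obtain ⟨a, b⟩ := w; simp [farSW, Face.side]
  · have e : ((farSW w).side .W).faces.1 = pocketSW w := by
      obtain ⟨a, b⟩ := w; simp [farSW, pocketSW, Face.side, MidEdge.faces]; ring
    rw [e]; exact hP

end ΩG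

end Literature.Probability.RandomPlanarGeometry.SAW.YangBaxter

namespace Literature.Barriers.CriticalPhenomena.PlaquetteWalk

open Literature.Probability.RandomPlanarGeometry.SAW.YangBaxter
open Real Complex

/-! ## §3 Boxes -/

section Boxes

variable {m n : ℕ} {S : List Face} {h : Face}

/-- ★★★★★ **ALL BOXES WITH `rootE` IN THE LAST COLUMN (`h.1 + 3 = m`), ANY FURTHER DEFECTS: `K_S1 = (h.1 + 2, h.2 − 2)` AND `holeS =
(h.1, h.2 − 1)` REMOVED ⇒ NO WOUND UNDER-WALK.** [cite: GlazmanManolescu2019, Lemma 2.1 (statement, "in the form given in [Gl]"), §2.1]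
[cite: Glazman2015WeightedSAW, Lemma 3.1 (proof, pp. 6–7)] [cite: CourantRobbins1958, Ch. V Appendix §2 (the even–odd rule)] -/
theorem lawL_box_killSE_holeS_eastCol_not_wound_under (hW : 1 ≤ h.1) (hE3 : h.1 + 3 = m) (hS0 : 0 ≤ h.2) (hN : h.2 + 1 ≤ n)
    (hh : h ∈ S) (hfS : ((h.1 - 1, h.2) : Face) ∉ S) (hcK : ((h.1 + 2, h.2 - 2) : Face) ∈ S)
    (hcH : ((h.1, h.2 - 1) : Face) ∈ S)
    (ω : ΩG (dom (boxMinus m n S)) (Face.side (h.1 + 1, h.2) .W) (farW (h.1 + 1, h.2))) (hb : ω.IsB2a)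
    (hS' : ω.2.firstSideG = .S) (θ : ℝ) :
    ω.WE (fun _ => θ) = excursionWinding θ ω.2.firstSideG
      (ω.z1 (rootedFace_hroot_boxMinus_of_mem (farW_hroot_mem_boxMinus_of_not_mem hW (by omega) hS0 hN hfS) hh) hb)
      ω.1 := by
  refine ΩG.WE_eq_excursionWinding_of_under_killSE_holeS_eastWall ?_ ?_ ?_ (fun f hf => ?_) ω _ hb hS' θ
  · rw [holeFaceW_hroot]; exact not_mem_dom_boxMinus_of_mem hh
  · have e : killSE ((h.1 + 1, h.2) : Face) = (h.1 + 2, h.2 - 2) := Prod.ext (by simp only [killSE]; ring) rfl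
    rw [e]; exact not_mem_dom_boxMinus_of_mem hcK
  · have e : ((h.1 + 1 - 1, h.2 - 1) : Face) = (h.1, h.2 - 1) := Prod.ext (by simp only; ring) rfl
    rw [e]; exact not_mem_dom_boxMinus_of_mem hcH
  · have := (mem_dom_boxMinus.1 hf).1.2.1
    simp only; omega

/-- ★★★★★ **ALL BOXES WITH `rootE` IN THE LAST COLUMN (`h.1 + 3 = m`), ANY FURTHER DEFECTS: `K_S1` AND `rootSS = (h.1 + 1, h.2 − 2)`
REMOVED ⇒ NO WOUND UNDER-WALK.** [cite: GlazmanManolescu2019, Lemma 2.1 (statement, "in the form given in [Gl]"), §2.1]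
[cite: Glazman2015WeightedSAW, Lemma 3.1 (proof, pp. 6–7)] [cite: CourantRobbins1958, Ch. V Appendix §2 (the even–odd rule)] -/
theorem lawL_box_killSE_rootSS_eastCol_not_wound_under (hW : 1 ≤ h.1) (hE3 : h.1 + 3 = m) (hS0 : 0 ≤ h.2) (hN : h.2 + 1 ≤ n)
    (hh : h ∈ S) (hfS : ((h.1 - 1, h.2) : Face) ∉ S) (hcK : ((h.1 + 2, h.2 - 2) : Face) ∈ S)
    (hcR : ((h.1 + 1, h.2 - 2) : Face) ∈ S)
    (ω : ΩG (dom (boxMinus m n S)) (Face.side (h.1 + 1, h.2) .W) (farW (h.1 + 1, h.2))) (hb : ω.IsB2a)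
    (hS' : ω.2.firstSideG = .S) (θ : ℝ) :
    ω.WE (fun _ => θ) = excursionWinding θ ω.2.firstSideG
      (ω.z1 (rootedFace_hroot_boxMinus_of_mem (farW_hroot_mem_boxMinus_of_not_mem hW (by omega) hS0 hN hfS) hh) hb)
      ω.1 := by
  refine ΩG.WE_eq_excursionWinding_of_under_killSE_rootSS_eastWall ?_ ?_ ?_ (fun f hf => ?_) ω _ hb hS' θ
  · rw [holeFaceW_hroot]; exact not_mem_dom_boxMinus_of_mem hh
  · have e : killSE ((h.1 + 1, h.2) : Face) = (h.1 + 2, h.2 - 2) := Prod.ext (by simp only [killSE]; ring) rfl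
    rw [e]; exact not_mem_dom_boxMinus_of_mem hcK
  · exact not_mem_dom_boxMinus_of_mem hcR
  · have := (mem_dom_boxMinus.1 hf).1.2.1
    simp only; omega

/-- ★★★★★ **ALL BOXES WITH TWO ROWS BELOW THE HOLE (`h.2 = 2`), ANY FURTHER DEFECTS: `K_S2 = (h.1 − 2, 0)` AND THE WESTERN POCKET
`(h.1 − 2, 1)` REMOVED ⇒ NO WOUND UNDER-WALK** (the far cell's western column may stand anywhere: with it on the wall this was
`PlaquetteWalkHoleRootWallPocket`). [cite: GlazmanManolescu2019, Lemma 2.1 (statement, "in the form given in [Gl]"), §2.1]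
[cite: Glazman2015WeightedSAW, Lemma 3.1 (proof, pp. 6–7)] [cite: CourantRobbins1958, Ch. V Appendix §2 (the even–odd rule)] -/
theorem lawL_box_killSW_pocketSW_h2_not_wound_under (hW : 2 ≤ h.1) (hE : h.1 ≤ m) (hS2 : h.2 = 2) (hN : 3 ≤ n)
    (hh : h ∈ S) (hfS : ((h.1 - 1, h.2) : Face) ∉ S) (hcK : ((h.1 - 2, 0) : Face) ∈ S) (hcP : ((h.1 - 2, 1) : Face) ∈ S)
    (ω : ΩG (dom (boxMinus m n S)) (Face.side (h.1 + 1, h.2) .W) (farW (h.1 + 1, h.2))) (hb : ω.IsB2a)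
    (hS' : ω.2.firstSideG = .S) (θ : ℝ) :
    ω.WE (fun _ => θ) = excursionWinding θ ω.2.firstSideG
      (ω.z1 (rootedFace_hroot_boxMinus_of_mem (farW_hroot_mem_boxMinus_of_not_mem (by omega) hE (by omega) (by omega) hfS)
        hh) hb) ω.1 := by
  refine ΩG.WE_eq_excursionWinding_of_under_killSW_pocketSW_column ?_ ?_ ?_ (Y := 0) (by simp only; omega)
    (fun y hy hy' => by simp only at hy'; omega) (fun f hf => ?_) ω _ hb hS' θ
  · rw [holeFaceW_hroot]; exact not_mem_dom_boxMinus_of_mem hh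
  · have e : killSW ((h.1 + 1, h.2) : Face) = (h.1 - 2, 0) := Prod.ext (by simp only [killSW]; ring) (by simp only [killSW]; omega)
    rw [e]; exact not_mem_dom_boxMinus_of_mem hcK
  · have e : pocketSW ((h.1 + 1, h.2) : Face) = (h.1 - 2, 1) :=
      Prod.ext (by simp only [pocketSW]; ring) (by simp only [pocketSW]; omega)
    rw [e]; exact not_mem_dom_boxMinus_of_mem hcP
  · exact (mem_dom_boxMinus.1 hf).1.2.2.1

end Boxes

end Literature.Barriers.CriticalPhenomena.PlaquetteWalk
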